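import Summits.BirchSwinnertonDyer.BirchSwinnertonDyer.Theorems.KolyvaginDepthDoorKNSupplyExactReadingDepthRowLB
import Summits.BirchSwinnertonDyer.BirchSwinnertonDyer.Theorems.KolyvaginDepthDoorDepthTableRowsOfPrint6
import Summits.BirchSwinnertonDyer.BirchSwinnertonDyer.Theorems.KolyvaginDepthDoorDepthTableRowKit
import Summits.BirchSwinnertonDyer.BirchSwinnertonDyer.Theorems.KolyvaginDepthDoorDepthTableRowKitPrint
import Summits.BirchSwinnertonDyer.BirchSwinnertonDyer.Theorems.Rank2ObservatoryKernelCerts002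
import Literature.NumberTheory.EllipticCurves.HeegnerHypothesisKroneckerProofs
import Literature.NumberTheory.EllipticCurves.AdditiveReductionSemistableModelProofs
import HarnessLib

/-!
# Route `KolyvaginDepthDoor`, crux `KolyvaginDepthSupplyKN` (stmt-BirchSwinnertonDyer-22820) —
# THE LAST DEPTH-TABLE ROW READ EXACTLY: `944e1` at `(5, −31)` (♠ (2)-residual, additive at `2` with
# `v₂(Δ) = 10`): an ADDITIVE-AWARE Kodaira–Néron table, and the row from two known points

Helper file of the lead prover of line `levelone` (kdd-p1 g14; `--supports stmt-BirchSwinnertonDyer-22820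
--as helper`); it closes nothing and BSD is not proved by it.

The per-curve exact rows (`KolyvaginDepthDoorDepthTableRowsExactReading{,Zhang1,Zhang2,Zhang3}`) cover
17 of the 18 rank-2 depth-table curves. The Kodaira–Néron condition «`p ∤ ord_v(Δ_min)` at every
MULTIPLICATIVE place» was read off the discriminant table by
`not_dvd_ordMinimalDiscriminant_of_intModel_table`, which asks `p ∤ v_q(Δ)` at EVERY small prime
`q ∣ Δ` — too much for `944e1 = [0, 0, 0, −19, 34]`, whose ADDITIVE prime `2` has `v₂(Δ) = 10`. This
file adds the additive-aware table (a prime `q` with `q ∣ c₄(E₀)` is additive, Silverman VII.5.1 (c),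
hence not a multiplicative place: `hasAdditiveReductionAt_of_dvd_of_dvd`) and reads the row:

* `not_dvd_ordMinimalDiscriminant_of_intModel_table_additive` — (KN_p) from the integer model, the
  table allowing the escape `q ∣ c₄(E₀)` at additive primes.
* `C944e1.exactRow_5_neg31` — for ANY imaginary quadratic `K` with `d_K = −31` (`5` split):
  «∃ frame, Kolyvagin prime `ℓ`, datum: `c_1(ℓ) ≠ 0`» `↔` «`rank E(ℚ) = 2` ∧ `Ш(E/ℚ)[5] = 0` ∧
  `#Sel_5(E^{(−31)}/ℚ) ≤ 5`», every side condition kernel-discharged; modulo (γ) and the five print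
  facts of the split supply (Castella–Sano Thm. 3, Zanarella 2.18, Howard–Zanarella, modularity, Mazur).

With this file ALL 18 rank-2 rows of the depth table are read exactly. CONDITIONAL on the named facts;
per curve; BSD is NOT proved by any of this.

References: [SilvermanAEC2009] VII.5 Prop. 5.1 (c), VIII.8; [GrossLMS1991] Prop. 3.7 (2);
[CastellaSano2026] Thm. 3; [JetchevLauterStein2009] §3.6 (arXiv:0707.0032); [CremonaAlgorithms1997]
Table 1 (944e1).
-/

set_option linter.dupNamespace false

noncomputable section

open scoped Classical NumberField

namespace Summit.BirchSwinnertonDyer.BirchSwinnertonDyer.Theorems.KolyvaginDepthDoor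

open Literature.NumberTheory.EllipticCurves Literature.NumberTheory.EllipticCurves.ModularForms
  WeierstrassCurve NumberField IsDedekindDomain
open Summit.BirchSwinnertonDyer.BirchSwinnertonDyer.Theorems
open Summit.BirchSwinnertonDyer.BirchSwinnertonDyer.Rank2Observatory

/-! ## (KN_p) read off the integer model, additive-aware -/

section KodairaNeron

variable {W : WeierstrassCurve ℚ} [W.IsElliptic] [W.IsGloballyMinimal]

/-- **(KN_p) from the integer model, additive primes allowed**: with `integralModelInt W = E₀`,
`Δ(E₀) = Δ₀`, `c₄(E₀) = c₀`, `|Δ₀| < B^p`, and a table saying that every prime `q < B` dividing `Δ₀`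
either divides `c₀` (then `q` is ADDITIVE, Silverman VII.5.1 (c), and no multiplicative place lies over
it) or has `q^e ∥ Δ₀` with `p ∤ e`: `p ∤ ord_v(Δ_min)` at every multiplicative place `v`. (For `q ≥ B`,
`q^{v_q(Δ₀)} ≤ |Δ₀| < B^p ≤ q^p` forces `v_q(Δ₀) < p`.) The table is `decide`-able.
[cite: SilvermanAEC2009, VII.5 Prop. 5.1 (c), VIII.8] -/
theorem not_dvd_ordMinimalDiscriminant_of_intModel_table_additive {E₀ : WeierstrassCurve ℤ}
    (hI : integralModelInt W = E₀) {p : ℕ} {Δ₀ c₀ : ℤ} (hΔ : E₀.Δ = Δ₀) (hc : E₀.c₄ = c₀) {B : ℕ}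
    (hB : Δ₀.natAbs < B ^ p)
    (htab : ∀ q ∈ Finset.range B, q.Prime → q ∣ Δ₀.natAbs → (q : ℤ) ∣ c₀ ∨
      ∃ e ∈ Finset.range 64, q ^ e ∣ Δ₀.natAbs ∧ ¬ q ^ (e + 1) ∣ Δ₀.natAbs ∧ ¬ p ∣ e)
    (v : HeightOneSpectrum (𝓞 ℚ)) (hv : W.HasMultiplicativeReductionAt v) :
    ¬ p ∣ W.ordMinimalDiscriminant v := by
  set q := Rat.HeightOneSpectrum.natGenerator v with hq
  have hqP : q.Prime := Rat.HeightOneSpectrum.prime_natGenerator v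
  haveI : Fact q.Prime := ⟨hqP⟩
  -- `ord_v(Δ_min) = v_q(Δ₀)`
  have hord : W.ordMinimalDiscriminant v = padicValNat q Δ₀.natAbs := by
    rw [ordMinimalDiscriminant_eq_padicValInt_natGenerator_ringOfIntegers v, padicValInt,
      WeierstrassCurve.minimalDiscriminantInt, hI, hΔ]
  -- multiplicative ⟹ `ord_v(Δ_min) ≠ 0`
  have hne : W.ordMinimalDiscriminant v ≠ 0 := fun h0 ↦
    hv.not_hasGoodReductionAt ((W.ordMinimalDiscriminant_eq_zero_iff_holds v).mp h0)
  rw [hord] at hne ⊢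
  set n := Δ₀.natAbs with hn
  have hn0 : n ≠ 0 := by
    intro h0
    rw [h0, padicValNat_zero_right] at hne
    exact hne rfl
  have hk1 : 1 ≤ padicValNat q n := Nat.one_le_iff_ne_zero.mpr hne
  have hqn : q ∣ n := dvd_of_one_le_padicValNat hk1
  have hqk : q ^ padicValNat q n ∣ n := pow_padicValNat_dvd
  by_cases hqB : q < B
  · rcases htab q (Finset.mem_range.mpr hqB) hqP hqn with hqc | ⟨e, -, he, he1, hpe⟩
    · -- `q ∣ c₄(E₀)` and `q ∣ Δ(E₀)`: `v` is additive, not multiplicative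
      exfalso
      have hΔ' : ((Rat.HeightOneSpectrum.primesEquiv v : ℕ) : ℤ) ∣ minimalDiscriminantInt W := by
        show (q : ℤ) ∣ minimalDiscriminantInt W
        rw [WeierstrassCurve.minimalDiscriminantInt, hI, hΔ]
        exact Int.natCast_dvd.mpr hqn
      have hc₄' : ((Rat.HeightOneSpectrum.primesEquiv v : ℕ) : ℤ) ∣ (integralModelInt W).c₄ := by
        show (q : ℤ) ∣ (integralModelInt W).c₄
        rw [hI, hc]
        exact hqc
      exact (W.hasAdditiveReductionAt_of_dvd_of_dvd v hΔ' hc₄').not_hasMultiplicativeReductionAt hv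
    · -- the table fixes `v_q(n) = e` with `p ∤ e`
      have hle : e ≤ padicValNat q n := (padicValNat_dvd_iff_le hn0).mp he
      have hlt : ¬ e + 1 ≤ padicValNat q n := fun h ↦ he1 ((padicValNat_dvd_iff_le hn0).mpr h)
      have heq : padicValNat q n = e := by omega
      rwa [heq]
  · -- `q ≥ B`: `q ^ v_q(n) ≤ n < B ^ p ≤ q ^ p`, so `1 ≤ v_q(n) < p`
    push Not at hqB
    have hle : q ^ padicValNat q n ≤ n := Nat.le_of_dvd (Nat.pos_of_ne_zero hn0) hqk
    have hBq : B ^ p ≤ q ^ p := Nat.pow_le_pow_left hqB p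
    have hlt : q ^ padicValNat q n < q ^ p := lt_of_le_of_lt hle (lt_of_lt_of_le hB hBq)
    have hkp : padicValNat q n < p := (Nat.pow_lt_pow_iff_right hqP.one_lt).mp hlt
    intro hdvd
    exact absurd (Nat.le_of_dvd hk1 hdvd) (not_le.mpr hkp)

end KodairaNeron

/-- `5` splits in a quadratic field of discriminant `D` when `(D/5) = 1` (decomposition law, via
`satisfiesHeegnerHypothesis_iff_kronecker` at level `5`). [folklore] -/
private theorem satisfiesHeegnerHypothesis_five_of_jacobiSym' (K : Type) [Field K] [NumberField K]
    (h2 : Module.finrank ℚ K = 2) {D : ℤ} (hD : NumberField.discr K = D) (hj : jacobiSym D 5 = 1) :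
    SatisfiesHeegnerHypothesis 5 K := by
  rw [satisfiesHeegnerHypothesis_iff_kronecker 5 K h2, hD]
  intro q hq hq5
  have hq' : q = 5 := (Nat.prime_dvd_prime_iff_eq hq (by norm_num)).mp hq5
  subst hq'
  exact ⟨fun h ↦ absurd h (by norm_num), fun _ ↦ hj⟩

/-! ## `944e1 = [0, 0, 0, -19, 34]` at `(p, d_K) = (5, -31)` (♠ (2)-residual: `N = 2⁴·59`; `Δ = −60416 = −2¹⁰·59`, `c₄ = 912`; `5` split) -/

namespace C944e1

/-- **DEPTH-TABLE ROW `944e1`, `(p, d_K) = (5, −31)`, READ EXACTLY (two-sided; no `hF`, no twist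
point, no twist pinning, no 2-descent).** For `E = 944e1` (two independent points by
`KernelCerts002.C944e1.two_le_rank`) and ANY imaginary quadratic `K` with `d_K = −31`: «some frame,
some Kolyvagin prime `ℓ` (e.g. `ℓ = 239`), some datum of conductor `ℓ` with `c_1(ℓ) ≠ 0`» `↔`
«`rank E(ℚ) = 2` ∧ `Ш(E/ℚ)[5] = 0` ∧ `#Sel_5(E^{(−31)}/ℚ) ≤ 5`». Side conditions all kernel theorems:
`5` good ordinary, `ρ_{E,5^n}` onto, non-CM, Kodaira–Néron at `5` by the ADDITIVE-AWARE table
(`2 ∣ c₄ = 912`, `59 ∥ Δ`), Heegner for `N_E`, `5` split in `K` as `(−31/5) = 1`. CONDITIONAL on (γ)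
and the five print facts; per curve; BSD is not proved by it. [cite: GrossLMS1991, Prop. 3.7 (2)]
[cite: CastellaSano2026, Thm. 3] [cite: JetchevLauterStein2009, §3.6 (arXiv:0707.0032)]
[cite: CremonaAlgorithms1997, Table 1 (944e1)] -/
theorem exactRow_5_neg31
    (h372 : GrossLMS1991.prop37_2_frobeniusCongruence)
    (h3 : Literature.NumberTheory.EllipticCurves.CastellaSano2026_kolyvaginClass_selmerDivisibility_eq_padicValNat_tamagawaProduct)
    (hZ : Literature.NumberTheory.EllipticCurves.Zanarella2019_kolyvaginClass_one_ne_zero_of_not_selmerDivisible)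
    (hHZ : Literature.NumberTheory.EllipticCurves.HowardZanarella_exists_minimal_kolyvaginClass_one_selmerCard_of_ne_zero)
    (hnf : exists_isNewformOf) (hMaz : mazur_not_dvd_maninConstant_of_odd)
    (K : Type) [Field K] [NumberField K] (hK : IsImaginaryQuadratic K)
    (hD : NumberField.discr K = -31) :
    haveI := isElliptic_c944e1;
    haveI := isGloballyMinimal_c944e1;
    haveI : NeZero (((⟨0, 0, 0, -19, 34⟩ : WeierstrassCurve ℤ).map (Int.castRingHom ℚ)).conductorNorm ℤ) :=
      neZero_conductorNorm_of_isElliptic _;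
    haveI := Fact.mk (by norm_num : Nat.Prime 5);
    (∃ (Dt : ModularParametrizationData ((⟨0, 0, 0, -19, 34⟩ : WeierstrassCurve ℤ).map (Int.castRingHom ℚ))
        (((⟨0, 0, 0, -19, 34⟩ : WeierstrassCurve ℤ).map (Int.castRingHom ℚ)).conductorNorm ℤ)) (β : ℤ)
      (ι : K →+* ℂ) (ℓ : ℕ) (d : KolyvaginHeegnerData Dt β ι ℓ),
      ℓ.Prime ∧ Zhang2014.IsKolyvaginPrime
        (((⟨0, 0, 0, -19, 34⟩ : WeierstrassCurve ℤ).map (Int.castRingHom ℚ)).conductorNorm ℤ)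
        ((⟨0, 0, 0, -19, 34⟩ : WeierstrassCurve ℤ).map (Int.castRingHom ℚ)) K 5 ℓ ∧
        d.kolyvaginClass (p := 5) (by norm_num) 1 ≠ 0) ↔
    (((⟨0, 0, 0, -19, 34⟩ : WeierstrassCurve ℤ).map (Int.castRingHom ℚ)).mordellWeilRank = 2 ∧
      ((((⟨0, 0, 0, -19, 34⟩ : WeierstrassCurve ℤ).map (Int.castRingHom ℚ))).sha ⊓
        AddSubgroup.torsionBy ((⟨0, 0, 0, -19, 34⟩ : WeierstrassCurve ℤ).map (Int.castRingHom ℚ)).galH1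
          ((5 : ℕ) : ℤ) : AddSubgroup _) = ⊥ ∧
      Nat.card ((((⟨0, 0, 0, -19, 34⟩ : WeierstrassCurve ℤ).map (Int.castRingHom ℚ)).quadraticTwist
        (NumberField.discr K : ℚ)).selmerGroup (5 : ℕ)) ≤ 5) := by
  haveI := isElliptic_c944e1
  haveI := isGloballyMinimal_c944e1
  haveI : NeZero (((⟨0, 0, 0, -19, 34⟩ : WeierstrassCurve ℤ).map (Int.castRingHom ℚ)).conductorNorm ℤ) :=
    neZero_conductorNorm_of_isElliptic _
  haveI := Fact.mk (by norm_num : Nat.Prime 5)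
  have hgo := goodOrdinary_5
  have hH := satisfiesHeegnerHypothesis_conductorNorm_of_intModel intModel K hK.1 hD heegner_neg31
  have hKN := not_dvd_ordMinimalDiscriminant_of_intModel_table_additive intModel (p := 5)
    (Δ₀ := -60416) (c₀ := 912) (by decide +kernel) (by decide +kernel) (B := 11) (by decide +kernel)
    (by decide +kernel)
  have hodd : Odd (NumberField.discr K) := by rw [hD, Int.odd_iff]; norm_num
  have hD3 : NumberField.discr K ≠ -3 := by rw [hD]; norm_num
  have hD4 : NumberField.discr K ≠ -4 := by rw [hD]; norm_num
  have hpD : ¬ (((5 : ℕ) : ℤ) ∣ NumberField.discr K) := by rw [hD]; norm_num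
  have hspl : SatisfiesHeegnerHypothesis 5 K :=
    satisfiesHeegnerHypothesis_five_of_jacobiSym' K hK.1 hD (by norm_num)
  exact kolyvaginClass_prime_ne_zero_iff_rankTwo_shaTrivial_twistSelmer_of_maninPrint h372 h3 hZ hHZ hnf
    hMaz _ not_hasCM KernelCerts002.C944e1.two_le_rank 5 (by norm_num) hgo.1 hgo.2
    hasSurjectiveModNGaloisRep_pow_5 hKN K hK hodd hD3 hD4 hpD hspl hH

end C944e1

end Summit.BirchSwinnertonDyer.BirchSwinnertonDyer.Theorems.KolyvaginDepthDoor

end
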